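import Mathlib.Probability.BrownianMotion.Basic
import Mathlib.MeasureTheory.Constructions.BorelSpace.Metrizable
import HarnessLib

/-!
# A measurable version of a continuous-path process with a.e.-measurable marginals

Topic `Probability/Process`; theorems only. Mathlib's `ProbabilityTheory.IsBrownianReal B P` only
makes the marginals `B t` *almost everywhere* measurable (`IsPreBrownianReal.aemeasurable`), while
the law-transport statements of the tree (`IsPreBrownianReal.map_path_eq`,
`Literature.Probability.RandomPlanarGeometry.map_eq_map_drivingPath`, …) need a process which is a
genuine random element of path space, i.e. with *measurable* marginals. For a process all of whose
paths are continuous this is repaired at no cost: there is a process `B'` with measurable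
marginals, all paths continuous, and **indistinguishable** from `B` — `B' = B` identically outside
one measurable null set (`exists_measurable_version_of_continuous`): modify `B` to the zero path on
a null set containing the exceptional sets of measurable representatives at a dense sequence of
times; off that set `B t = limₖ B (dₖ)` along dense times `dₖ → t`, a pointwise limit of measurable
functions. For a Brownian motion the version is again a Brownian motion
(`IsBrownianReal.exists_measurable_version`). This is the routine "we may assume the process is
measurable" step (Revuz–Yor (1999), Ch. I, §1, Def. (1.6)–(1.7): versions and indistinguishable
processes; two a.s.-continuous versions of each other are indistinguishable).

## References

* D. Revuz, M. Yor, *Continuous Martingales and Brownian Motion* (3rd ed., 1999), Ch. I §1,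
  (1.6)–(1.7). [folklore]
-/

noncomputable section

open MeasureTheory ProbabilityTheory Filter Topology Set

open scoped NNReal

namespace Literature.Probability.Process

variable {Ω : Type*} {mΩ : MeasurableSpace Ω} {B : ℝ≥0 → Ω → ℝ} {P : Measure Ω}

/-- **A continuous-path process with a.e.-measurable marginals has an indistinguishable version
with measurable marginals and continuous paths.** Revuz–Yor (1999), Ch. I, (1.6)–(1.7). [folklore] -/
theorem exists_measurable_version_of_continuous (hm : ∀ t, AEMeasurable (B t) P)
    (hc : ∀ ω, Continuous (B · ω)) :
    ∃ B' : ℝ≥0 → Ω → ℝ, (∀ t, Measurable (B' t)) ∧ (∀ ω, Continuous (B' · ω)) ∧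
      ∃ N : Set Ω, MeasurableSet N ∧ P N = 0 ∧ ∀ ω, ω ∉ N → ∀ t, B' t ω = B t ω := by
  -- a dense sequence of times and measurable representatives there
  obtain ⟨d, hd⟩ := TopologicalSpace.exists_dense_seq ℝ≥0
  set g : ℕ → Ω → ℝ := fun n ↦ (hm (d n)).mk with hg
  have hgm : ∀ n, Measurable (g n) := fun n ↦ (hm (d n)).measurable_mk
  have hgae : ∀ n, B (d n) =ᵐ[P] g n := fun n ↦ (hm (d n)).ae_eq_mk
  -- the exceptional null set
  set N₀ : Set Ω := ⋃ n, {ω | B (d n) ω ≠ g n ω} with hN₀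
  have hN₀ : P N₀ = 0 := by
    refine measure_iUnion_null fun n ↦ ?_
    exact ae_iff.1 (hgae n)
  obtain ⟨N, hN₀N, hN, hPN⟩ := exists_measurable_superset_of_null hN₀
  refine ⟨fun t ↦ Nᶜ.indicator (B t), fun t ↦ ?_, fun ω ↦ ?_, N, hN, hPN, fun ω hω t ↦ ?_⟩
  · -- measurability: a pointwise limit of `Nᶜ.indicator (g (φ k))` along `d (φ k) → t`
    have ht : t ∈ closure (range d) := by rw [hd.closure_range]; exact mem_univ t
    obtain ⟨u, hu, hut⟩ := mem_closure_iff_seq_limit.1 ht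
    choose φ hφ using fun k ↦ mem_range.1 (hu k)
    refine measurable_of_tendsto_metrizable (f := fun k ↦ Nᶜ.indicator (g (φ k)))
      (fun k ↦ (hgm (φ k)).indicator hN.compl) (tendsto_pi_nhds.2 fun ω ↦ ?_)
    by_cases hω : ω ∈ N
    · simp only [indicator_of_notMem (notMem_compl_iff.2 hω)]
      exact tendsto_const_nhds
    · simp only [indicator_of_mem (mem_compl hω)]
      have hωg : ∀ n, g n ω = B (d n) ω := fun n ↦ by
        by_contra h
        exact hω (hN₀N (mem_iUnion.2 ⟨n, fun h' ↦ h h'.symm⟩))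
      have h1 : (fun k ↦ g (φ k) ω) = fun k ↦ B (u k) ω := funext fun k ↦ by rw [hωg, hφ]
      rw [h1]
      exact ((hc ω).tendsto t).comp hut
  · -- continuity of paths
    by_cases hω : ω ∈ N
    · simp only [indicator_of_notMem (notMem_compl_iff.2 hω)]
      exact continuous_const
    · simp only [indicator_of_mem (mem_compl hω)]
      exact hc ω
  · simp only [indicator_of_mem (mem_compl hω)]

/-- For a version as above, `B t = B' t` almost everywhere, for every `t`. [folklore] -/
theorem ae_eq_of_forall_notMem {B' : ℝ≥0 → Ω → ℝ} {N : Set Ω} (hPN : P N = 0)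
    (h : ∀ ω, ω ∉ N → ∀ t, B' t ω = B t ω) (t : ℝ≥0) : B t =ᵐ[P] B' t := by
  have : {ω | B t ω ≠ B' t ω} ⊆ N := fun ω hω ↦ by
    by_contra hωN
    exact hω (h ω hωN t).symm
  exact measure_mono_null this hPN

/-- **A Brownian motion with everywhere-continuous paths has an indistinguishable version which is
a Brownian motion with measurable marginals and everywhere-continuous paths.** Dot-notation
extension deliberately declared in Mathlib's namespace `ProbabilityTheory.IsBrownianReal`.
Revuz–Yor (1999), Ch. I, (1.6)–(1.7). [folklore] -/
theorem _root_.ProbabilityTheory.IsBrownianReal.exists_measurable_version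
    (hB : IsBrownianReal B P) (hc : ∀ ω, Continuous (B · ω)) :
    ∃ B' : ℝ≥0 → Ω → ℝ, IsBrownianReal B' P ∧ (∀ t, Measurable (B' t)) ∧
      (∀ ω, Continuous (B' · ω)) ∧
      ∃ N : Set Ω, MeasurableSet N ∧ P N = 0 ∧ ∀ ω, ω ∉ N → ∀ t, B' t ω = B t ω := by
  obtain ⟨B', hm, hc', N, hN, hPN, hNB⟩ :=
    exists_measurable_version_of_continuous (fun t ↦ hB.aemeasurable t) hc
  refine ⟨B', ⟨hB.toIsPreBrownianReal.congr fun t ↦ ae_eq_of_forall_notMem hPN hNB t,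
    ae_of_all _ hc'⟩, hm, hc', N, hN, hPN, hNB⟩

/-- Events defined through the paths of two indistinguishable processes have the same
probability. [folklore] -/
theorem measure_setOf_path_eq_of_forall_notMem {B' : ℝ≥0 → Ω → ℝ} {N : Set Ω} (hPN : P N = 0)
    (h : ∀ ω, ω ∉ N → ∀ t, B' t ω = B t ω) (A : Set (ℝ≥0 → ℝ)) :
    P {ω | (fun t ↦ B t ω) ∈ A} = P {ω | (fun t ↦ B' t ω) ∈ A} := by
  refine measure_congr ?_
  have hN : ∀ᵐ ω ∂P, ω ∉ N := measure_eq_zero_iff_ae_notMem.1 hPN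
  filter_upwards [hN] with ω hω
  have hpath : (fun t ↦ B' t ω) = fun t ↦ B t ω := funext (h ω hω)
  simp only [eq_iff_iff]
  change (fun t ↦ B t ω) ∈ A ↔ (fun t ↦ B' t ω) ∈ A
  rw [hpath]

end Literature.Probability.Process
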